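import Mathlib
import Summits.NavierStokesRegularity.NavierStokesRegularity.Theorems.EulerZoomLiouvillePowerGaugeEulerLiouvillePressureBudgetRieszKernel
import Literature.Analysis.FluidPDE.NormalisedPressureLpClass
import Literature.Analysis.FluidPDE.NormalisedPressureCompactSupport
import Literature.Analysis.FluidPDE.RieszPressureModConstPoisson
import HarnessLib

/-!
# Crux `EulerZoomLiouville.PowerGaugeEulerLiouville` (stmt-NavierStokesRegularity-19832), t60-ΠLOG piece S4 (nsreg-p2 `r58/Sketch58c.lean`
# `RieszModConst`), part 2/3: THE LOCALISATION IDENTITY — at scale `R` the Riesz pressure modulo constants differs from the near pressure `p̃[w]` of a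
# localisation `w` by an EXPLICIT renormalised far integral, bounded by `D·R^{−2−2ρ}` on `B_R`

Route №10 `EulerZoomLiouville` (NavierStokesRegularity), crux E = stmt-NavierStokesRegularity-19832; width seat ns-ezl-w1 g10 under the LEAD ns-typeII-p2
(KEY S58c-4).  The witness of S4 is the continuous function
`Q[V] := −nearPotential ½ 1 V − farPotentialMod ½ 1 0 V` (cutoff radii `(½, 1)`; written out in every statement, no definition is introduced).

* `pressureSource_congr_of_eventuallyEq`, `nearPotential_congr_of_eqOn_ball` — LOCALITY: the near potential with outer radius `1` at `x ∈ B_R` sees only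
  `B(x, 1) ⊆ B_{2R}` (`R ≥ 1`), so it agrees for `V` and any localisation `w = V` on `B_{2R}`;
* `normalisedPressure_eq_near_far_half` — `p̃[w] = −Q₁^{½,1}[w] − Q₂^{½,1}[w]` for `w ∈ C²_c` (tree `normalisedPressure_eq_pressurePotential` +
  `pressurePotential_eq_scale` at `R = ½`);
* ★ `rieszMod_sub_normalisedPressure_eq` — THE IDENTITY: for `x ∈ B_R`, `Q[V](x) − p̃[w](x) − κ_w = −∫ [(D²Γ∞(x−y) − D²Γ∞(−y))(V y,V y) − (D²Γ∞(x−y) − D²Γ∞(−y))(w y,w y)] dy`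
  with the constant `κ_w = Q₂^{½,1}[w](0)`; the integrand vanishes for `|y| < 2R`;
* ★ `abs_rieszMod_sub_normalisedPressure_le` — THE BOUND: `|Q[V](x) − κ_w − p̃[w](x)| ≤ 2·M·C_ρ·A·R^{−2−2ρ}` on `B_R` (sharp two-centre bound × dyadic tail of
  part 1; `M`, `C_ρ` the constants of part 1, uniform in the localisation `w` with `|w| ≤ |V|`).

WHAT THIS IS NOT: not NS, not E, not the crux: part of an instrument (t60-ΠLOG) bearing on the bookkeeping of 19832; 19832 OPEN; no summit statement is
proved by this file.
[cite: GilbargTrudinger2001, Lemma 4.2; Seregin2014, §6.2 Lemma 6.5; Stein1970, Ch. II §2 Thm 1 (b)]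
-/

noncomputable section

-- flat `Theorems/<Route><Decl>…` files of one crux share the namespace of the crux (tree convention)
set_option linter.dupNamespace false

open MeasureTheory Set Filter Topology Metric Function
open scoped NNReal ENNReal RealInnerProductSpace ContDiff

namespace Summit.NavierStokesRegularity.NavierStokesRegularity.Theorems.PowerGaugeEulerLiouville.PressureSeam

open Literature.Analysis Literature.Analysis.FluidPDE
open Literature.Analysis.FluidPDE.RieszPressureModConst

-- nested operator types `ℝ³ →L[ℝ] ℝ³ →L[ℝ] ℝ³ →L[ℝ] ℝ`
set_option maxSynthPendingDepth 3

/-! ### Locality of the source and of the near potential -/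

/-- **The quadratic source is local**: `G[v](x) = ∂ᵢ∂ⱼ(vᵢvⱼ)(x)` depends on `v` near `x` only. [folklore] -/
theorem pressureSource_congr_of_eventuallyEq {v w : EuclideanSpace ℝ (Fin 3) → EuclideanSpace ℝ (Fin 3)} {x : EuclideanSpace ℝ (Fin 3)}
    (h : v =ᶠ[𝓝 x] w) : pressureSource v x = pressureSource w x := by
  have hF : (fun y => convect v v y + VectorCalculus.divergence v y • v y) =ᶠ[𝓝 x]
      (fun y => convect w w y + VectorCalculus.divergence w y • w y) := by
    filter_upwards [h.eventuallyEq_nhds] with y hy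
    simp only [convect, VectorCalculus.divergence, hy.fderiv_eq, hy.eq_of_nhds]
  have hD := hF.fderiv_eq (𝕜 := ℝ)
  rw [pressureSource_def, pressureSource_def]
  unfold VectorCalculus.divergence at hD ⊢
  rw [hD]

/-- **The near potential with outer radius `1` is local at scale `R ≥ 1`**: if `w = V` on `B(0, 2R)` then `Q₁^{½,1}[w] = Q₁^{½,1}[V]` on `B(0, R)`
(the near kernel vanishes for `|z| ≥ 1` and `B(x,1) ⊆ B(0,2R)` for `x ∈ B(0,R)`). [cite: GilbargTrudinger2001, Lemma 4.2] -/
theorem nearPotential_congr_of_eqOn_ball {V w : EuclideanSpace ℝ (Fin 3) → EuclideanSpace ℝ (Fin 3)} {R : ℝ} (hR : 1 ≤ R)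
    (hw : ∀ y ∈ ball (0 : EuclideanSpace ℝ (Fin 3)) (2 * R), w y = V y) {x : EuclideanSpace ℝ (Fin 3)}
    (hx : x ∈ ball (0 : EuclideanSpace ℝ (Fin 3)) R) :
    nearPotential (1 / 2) 1 w x = nearPotential (1 / 2) 1 V x := by
  unfold nearPotential
  refine integral_congr_ae (Eventually.of_forall fun z => ?_)
  show newtonNear (1 / 2) 1 z * pressureSource w (x - z) = newtonNear (1 / 2) 1 z * pressureSource V (x - z)
  by_cases hz : 1 ≤ ‖z‖
  · have h0 : newtonNear (1 / 2 : ℝ) 1 z = 0 := newtonNear_eq_zero (by norm_num) (by norm_num) hz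
    rw [h0, zero_mul, zero_mul]
  · rw [not_le] at hz
    rw [mem_ball_zero_iff] at hx
    have hmem : x - z ∈ ball (0 : EuclideanSpace ℝ (Fin 3)) (2 * R) := by
      rw [mem_ball_zero_iff]
      calc ‖x - z‖ ≤ ‖x‖ + ‖z‖ := norm_sub_le _ _
        _ < R + 1 := by linarith
        _ ≤ 2 * R := by linarith
    have hev : w =ᶠ[𝓝 (x - z)] V :=
      Filter.eventuallyEq_of_mem (isOpen_ball.mem_nhds hmem) fun y hy => hw y hy
    rw [pressureSource_congr_of_eventuallyEq hev]

/-! ### The near pressure of a localisation in the radii `(½, 1)` -/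

/-- **`p̃[w] = −Q₁^{½,1}[w] − Q₂^{½,1}[w]` for `w ∈ C²_c`** (Tao's normalised pressure is the pressure potential, which does not depend on the cutoff scale).
[cite: Tao2011, (35) and (42); GilbargTrudinger2001, Lemma 4.2] -/
theorem normalisedPressure_eq_near_far_half {w : EuclideanSpace ℝ (Fin 3) → EuclideanSpace ℝ (Fin 3)} (hw : ContDiff ℝ 2 w)
    (hwc : HasCompactSupport w) (x : EuclideanSpace ℝ (Fin 3)) :
    normalisedPressure w x = -nearPotential (1 / 2) 1 w x - farPotential (1 / 2) 1 w x := by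
  have hL2 : Integrable fun y => ‖w y‖ ^ 2 := integrable_norm_sq_of_hasCompactSupport hw.continuous hwc
  rw [normalisedPressure_eq_pressurePotential hw hL2 x, pressurePotential_eq_scale (by norm_num : (0 : ℝ) < 1 / 2) hw hL2 x]
  norm_num

/-! ### The localisation identity -/

/-- **THE LOCALISATION IDENTITY** (exact, no limits): for a `C²` field `V` with the velocity budget (`ρ > −3/2`), a `C²_c` localisation `w = V` on
`B(0,2R)` (`R ≥ 1`) and `x ∈ B(0,R)`,
`Q[V](x) − p̃[w](x) − Q₂^{½,1}[w](0) = −∫ [(D²Γ∞(x−y) − D²Γ∞(0−y))(V y, V y) − (D²Γ∞(x−y) − D²Γ∞(0−y))(w y, w y)] dy`,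
`Q[V] = −Q₁^{½,1}[V] − farPotentialMod ½ 1 0 V`: the near parts agree on `B(0,R)`, and `Q₂[w](x) = (Q₂[w](x) − Q₂[w](0)) + Q₂[w](0)`.
[cite: Seregin2014, §6.2 Lemma 6.5; GilbargTrudinger2001, Lemma 4.2] -/
theorem rieszMod_sub_normalisedPressure_eq {V : EuclideanSpace ℝ (Fin 3) → EuclideanSpace ℝ (Fin 3)} (hV : ContDiff ℝ 2 V)
    {ρ A : ℝ} (hρ : -3 / 2 < ρ)
    (hA : ∀ R : ℝ, 1 ≤ R → ∫ y in ball (0 : EuclideanSpace ℝ (Fin 3)) R, ‖V y‖ ^ 2 ≤ A * R ^ (1 - 2 * ρ))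
    {R : ℝ} (hR : 1 ≤ R) {w : EuclideanSpace ℝ (Fin 3) → EuclideanSpace ℝ (Fin 3)} (hw : ContDiff ℝ 2 w) (hwc : HasCompactSupport w)
    (hwV : ∀ y ∈ ball (0 : EuclideanSpace ℝ (Fin 3)) (2 * R), w y = V y)
    {x : EuclideanSpace ℝ (Fin 3)} (hx : x ∈ ball (0 : EuclideanSpace ℝ (Fin 3)) R) :
    (-nearPotential (1 / 2) 1 V x - farPotentialMod (1 / 2) 1 0 V x) - normalisedPressure w x - farPotential (1 / 2) 1 w 0 =
      -∫ y, ((fderiv ℝ (fderiv ℝ (newtonFar (1 / 2) 1)) (x - y) - fderiv ℝ (fderiv ℝ (newtonFar (1 / 2) 1)) (0 - y)) (V y) (V y) -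
        (fderiv ℝ (fderiv ℝ (newtonFar (1 / 2) 1)) (x - y) - fderiv ℝ (fderiv ℝ (newtonFar (1 / 2) 1)) (0 - y)) (w y) (w y)) := by
  have h₀ : (0 : ℝ) < 1 / 2 := by norm_num
  have h₁ : (1 / 2 : ℝ) < 1 := by norm_num
  set K := fderiv ℝ (fderiv ℝ (newtonFar (1 / 2 : ℝ) 1)) with hK
  have hwL2 : Integrable fun y => ‖w y‖ ^ 2 := integrable_norm_sq_of_hasCompactSupport hw.continuous hwc
  -- integrability of the four pieces
  have iV : Integrable fun y => (K (x - y) - K (0 - y)) (V y) (V y) :=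
    integrable_farIntegrand_of_budget h₀ h₁ hV.continuous hρ hA 0 x
  have iwx : Integrable fun y => K (x - y) (w y) (w y) := integrable_farPotential_integrand h₀ h₁ hw.continuous hwL2 x
  have iw0 : Integrable fun y => K (0 - y) (w y) (w y) := integrable_farPotential_integrand h₀ h₁ hw.continuous hwL2 0
  have iw : Integrable fun y => (K (x - y) - K (0 - y)) (w y) (w y) := by
    refine (iwx.sub iw0).congr (Eventually.of_forall fun y => ?_)
    simp only [Pi.sub_apply, sub_apply]
  -- the near parts agree, the near pressure splits
  rw [nearPotential_congr_of_eqOn_ball hR hwV hx |>.symm, normalisedPressure_eq_near_far_half hw hwc x]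
  unfold farPotentialMod farPotential
  rw [← hK, integral_sub iV iw]
  have e2 : ∫ y, (K (x - y) - K (0 - y)) (w y) (w y) = (∫ y, K (x - y) (w y) (w y)) - ∫ y, K (0 - y) (w y) (w y) := by
    rw [← integral_sub iwx iw0]
    exact integral_congr_ae (Eventually.of_forall fun y => by simp only [sub_apply])
  rw [e2]
  ring

/-- **THE BOUND ON `B_R`** (uniform in the localisation): with the constants `M` of the sharp two-centre bound and `C_ρ` of the dyadic tail (part 1), for
`V ∈ C²` with the budget, `R ≥ 1`, a `C²_c` localisation `w = V` on `B(0,2R)` with `|w| ≤ |V|`, and `x ∈ B(0,R)`: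
`|Q[V](x) − Q₂^{½,1}[w](0) − p̃[w](x)| ≤ 2·M·C_ρ·A·R^{−2−2ρ}` — the integrand of the localisation identity vanishes for `|y| < 2R` and is bounded by
`M‖x‖(1+|y|)⁻⁴·2|V y|²` beyond. [cite: Seregin2014, §6.2 Lemma 6.5; Stein1970, Ch. II §2 Thm 1 (b)] -/
theorem abs_rieszMod_sub_normalisedPressure_le {V : EuclideanSpace ℝ (Fin 3) → EuclideanSpace ℝ (Fin 3)} (hV : ContDiff ℝ 2 V)
    {ρ A : ℝ} (hρ : -3 / 2 < ρ)
    (hA : ∀ R : ℝ, 1 ≤ R → ∫ y in ball (0 : EuclideanSpace ℝ (Fin 3)) R, ‖V y‖ ^ 2 ≤ A * R ^ (1 - 2 * ρ))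
    {M : ℝ} (hM0 : 0 ≤ M)
    (hM : ∀ x₀ x y : EuclideanSpace ℝ (Fin 3), 2 * ‖x - x₀‖ ≤ ‖y - x₀‖ →
      ‖fderiv ℝ (fderiv ℝ (newtonFar (1 / 2 : ℝ) 1)) (x - y) - fderiv ℝ (fderiv ℝ (newtonFar (1 / 2 : ℝ) 1)) (x₀ - y)‖ ≤
        M * ‖x - x₀‖ * ((1 + ‖y - x₀‖) ^ 4)⁻¹)
    {R : ℝ} (hR : 1 ≤ R) {w : EuclideanSpace ℝ (Fin 3) → EuclideanSpace ℝ (Fin 3)} (hw : ContDiff ℝ 2 w) (hwc : HasCompactSupport w)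
    (hwV : ∀ y ∈ ball (0 : EuclideanSpace ℝ (Fin 3)) (2 * R), w y = V y) (hle : ∀ y, ‖w y‖ ≤ ‖V y‖)
    {x : EuclideanSpace ℝ (Fin 3)} (hx : x ∈ ball (0 : EuclideanSpace ℝ (Fin 3)) R) :
    |(-nearPotential (1 / 2) 1 V x - farPotentialMod (1 / 2) 1 0 V x) - farPotential (1 / 2) 1 w 0 - normalisedPressure w x| ≤
      2 * M * ((2 : ℝ) ^ (1 - 2 * ρ) * ((2 : ℝ) ^ (-3 - 2 * ρ) / (1 - 2 ^ (-3 - 2 * ρ)))) * A * R ^ (-2 - 2 * ρ) := by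
  have h₀ : (0 : ℝ) < 1 / 2 := by norm_num
  have h₁ : (1 / 2 : ℝ) < 1 := by norm_num
  have hR0 : 0 < R := by linarith
  set K := fderiv ℝ (fderiv ℝ (newtonFar (1 / 2 : ℝ) 1)) with hK
  set Cρ : ℝ := (2 : ℝ) ^ (1 - 2 * ρ) * ((2 : ℝ) ^ (-3 - 2 * ρ) / (1 - 2 ^ (-3 - 2 * ρ))) with hCρ
  have hid := rieszMod_sub_normalisedPressure_eq hV hρ hA hR hw hwc hwV hx
  have e : (-nearPotential (1 / 2) 1 V x - farPotentialMod (1 / 2) 1 0 V x) - farPotential (1 / 2) 1 w 0 - normalisedPressure w x =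
      (-nearPotential (1 / 2) 1 V x - farPotentialMod (1 / 2) 1 0 V x) - normalisedPressure w x - farPotential (1 / 2) 1 w 0 := by ring
  rw [e, hid, abs_neg]
  -- the tail and its integrability
  obtain ⟨htailInt, htail⟩ := setIntegral_tail_normSq_weight_le_of_budget hV.continuous hρ hA hR
  set S := {y : EuclideanSpace ℝ (Fin 3) | 2 * R ≤ ‖y‖} with hS
  have hSm : MeasurableSet S := measurableSet_le measurable_const measurable_norm
  have hxR : ‖x‖ < R := mem_ball_zero_iff.1 hx
  -- pointwise majorant: `S.indicator (2 M ‖x‖ · weight)`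
  set g : EuclideanSpace ℝ (Fin 3) → ℝ := S.indicator fun y => 2 * M * ‖x‖ * (‖V y‖ ^ 2 * ((1 + ‖y‖) ^ 4)⁻¹) with hg
  have hgi : Integrable g := by
    rw [hg, integrable_indicator_iff hSm]
    exact htailInt.const_mul (2 * M * ‖x‖)
  have hpt : ∀ y, ‖(K (x - y) - K (0 - y)) (V y) (V y) - (K (x - y) - K (0 - y)) (w y) (w y)‖ ≤ g y := by
    intro y
    by_cases hy : 2 * R ≤ ‖y‖
    · have hyS : y ∈ S := hy
      rw [hg, indicator_of_mem hyS]
      have h2x : 2 * ‖x - 0‖ ≤ ‖y - 0‖ := by rw [sub_zero, sub_zero]; linarith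
      have hk := hM 0 x y h2x
      rw [sub_zero, sub_zero] at hk
      set D := K (x - y) - K (0 - y) with hD
      have hDV : ‖D (V y) (V y)‖ ≤ ‖D‖ * ‖V y‖ ^ 2 := by
        calc ‖D (V y) (V y)‖ ≤ ‖D (V y)‖ * ‖V y‖ := ContinuousLinearMap.le_opNorm _ _
          _ ≤ ‖D‖ * ‖V y‖ * ‖V y‖ := by gcongr; exact ContinuousLinearMap.le_opNorm _ _
          _ = ‖D‖ * ‖V y‖ ^ 2 := by ring
      have hDw : ‖D (w y) (w y)‖ ≤ ‖D‖ * ‖V y‖ ^ 2 := by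
        calc ‖D (w y) (w y)‖ ≤ ‖D (w y)‖ * ‖w y‖ := ContinuousLinearMap.le_opNorm _ _
          _ ≤ ‖D‖ * ‖w y‖ * ‖w y‖ := by gcongr; exact ContinuousLinearMap.le_opNorm _ _
          _ ≤ ‖D‖ * ‖V y‖ * ‖V y‖ := by gcongr <;> exact hle y
          _ = ‖D‖ * ‖V y‖ ^ 2 := by ring
      have h4 : 0 ≤ ‖V y‖ ^ 2 * ((1 + ‖y‖) ^ 4)⁻¹ := by positivity
      calc ‖D (V y) (V y) - D (w y) (w y)‖ ≤ ‖D (V y) (V y)‖ + ‖D (w y) (w y)‖ := norm_sub_le _ _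
        _ ≤ ‖D‖ * ‖V y‖ ^ 2 + ‖D‖ * ‖V y‖ ^ 2 := add_le_add hDV hDw
        _ = 2 * (‖D‖ * ‖V y‖ ^ 2) := by ring
        _ ≤ 2 * (M * ‖x‖ * ((1 + ‖y‖) ^ 4)⁻¹ * ‖V y‖ ^ 2) := by gcongr
        _ = 2 * M * ‖x‖ * (‖V y‖ ^ 2 * ((1 + ‖y‖) ^ 4)⁻¹) := by ring
    · -- inside `B(0, 2R)` the integrand vanishes
      rw [not_le] at hy
      have hyS : y ∉ S := fun h => absurd (h : 2 * R ≤ ‖y‖) (not_le.2 hy)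
      rw [hg, indicator_of_notMem hyS, hwV y (mem_ball_zero_iff.2 hy), sub_self, norm_zero]
  have hint := norm_integral_le_of_norm_le hgi (Eventually.of_forall hpt)
  rw [Real.norm_eq_abs] at hint
  refine hint.trans ?_
  rw [hg, integral_indicator hSm, integral_const_mul]
  have h2 : 2 * M * ‖x‖ * ∫ y in S, ‖V y‖ ^ 2 * ((1 + ‖y‖) ^ 4)⁻¹ ≤ 2 * M * R * (Cρ * A * R ^ (-3 - 2 * ρ)) := by
    have hI0 : 0 ≤ ∫ y in S, ‖V y‖ ^ 2 * ((1 + ‖y‖) ^ 4)⁻¹ := integral_nonneg fun y => by positivity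
    calc 2 * M * ‖x‖ * ∫ y in S, ‖V y‖ ^ 2 * ((1 + ‖y‖) ^ 4)⁻¹
        ≤ 2 * M * R * ∫ y in S, ‖V y‖ ^ 2 * ((1 + ‖y‖) ^ 4)⁻¹ := by
          exact mul_le_mul_of_nonneg_right (mul_le_mul_of_nonneg_left hxR.le (by positivity)) hI0
      _ ≤ 2 * M * R * (Cρ * A * R ^ (-3 - 2 * ρ)) := mul_le_mul_of_nonneg_left htail (by positivity)
  refine h2.trans (le_of_eq ?_)
  have e3 : R ^ (-2 - 2 * ρ) = R * R ^ (-3 - 2 * ρ) := by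
    rw [show (-2 - 2 * ρ : ℝ) = 1 + (-3 - 2 * ρ) by ring, Real.rpow_add hR0, Real.rpow_one]
  rw [e3]; ring

end Summit.NavierStokesRegularity.NavierStokesRegularity.Theorems.PowerGaugeEulerLiouville.PressureSeam

end
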